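import Summits.QuantumFields.YangMills.Theorems.SwapVirialDeficitQuantitativeLaplaceFibredTaylor
import Summits.QuantumFields.YangMills.Theorems.SwapVirialDeficitQuantitativeLaplaceSkewProductChart
import HarnessLib

/-!
# The quantitative Laplace method on a SKEW PRODUCT `M × Y` (base × left-invariant group fibre), fibrewise at the implicit
# minimiser, with a BASE-DEPENDENT fibre minimum `f₀(p)` — the capstone of «architecture v2»
# (free-hands support of ⟨stmt-QuantumFields-24197⟩ `SwapVirialDeficit.SwapGluedStiffness`; generic, assembles
# ✓`laplaceMethod_quantitative_fibred_chart_of_taylor` with ✓`skewChart_restrict_image_eq_map`)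

THE STATEMENT (★★★ `laplaceMethod_quantitative_skewProduct_of_taylor`).  `(M, ν)` a finite measure space (base: near-flat leaders with Haar⁴),
`Y` a measurable group with a finite LEFT-INVARIANT measure `κ` (fibre: followers `SU(2)^{Fol}` with Haar), `V` an `m`-dimensional Euclidean space with
Lebesgue measure and a one-fibre chart `E : V → Y` on `B̄(0,R)` (`κ|_{E(B̄)} = E_*((j·dy)|_{B̄})`, `j ≥ 0`), a measurable section `s : M → Y` (the
fibre minimiser `y*(p)`, ✓`exists_fibreMinimiser` ∕ ✓`measurable_fibreMinimiser`), a phase `F` and an amplitude `φ` on `M × Y`, a measurable fibre-minimum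
profile `f₀ : M → ℝ≥0` and base weight `0 ≤ w₀ ∈ L¹(ν)`, a measurable uniformly `λ`-coercive field `A p` of symmetric fibre Hessians, and on every fibre
the EXISTENTIAL Taylor data on the ball: `|F(p, s(p)·E(y)) − f₀(p) − ½⟪A p y,y⟫ − τ_p(y)| ≤ B₄‖y‖⁴` (`τ_p` odd, `|τ_p| ≤ B₃‖y‖³`) and
`|j(y)·φ(p, s(p)·E(y)) − w₀(p)(1 + λ_p(y))| ≤ N₂w₀(p)‖y‖²` (`λ_p` odd, `|λ_p| ≤ N₁‖y‖`), smallness `(B₃+B₄R)R + B₄R² ≤ λ/(8(m+8))`, `(N₁+N₂R)R ≤ 1`,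
`N₂R² ≤ 1`; off the tube `Ψ(M × B̄(0,R))`, `Ψ(p,y) = (p, s(p)·E(y))`, the fibrewise separation `F(p,u) ≥ f₀(p) + η₀`, and `|φ| ≤ Φ₀`.  THEN for every `β > 0`

  `e^{−βF}φ ∈ L¹(ν⊗κ)` and `|∫_{M×Y} e^{−βF}φ d(ν⊗κ) − (2π/β)^{m/2}·∫_M e^{−βf₀(p)} w₀(p) (det A p)^{−1/2} dν(p)| ≤ (K/β)·(main) + Φ₀·(ν⊗κ)(M×Y)·e^{−βη₀}`,

`K` the explicit dimension-polynomial constant of the core at `A₃ = B₃+B₄R`, `A₄ = B₄`, `D = N₁+N₂R`, `G = N₂`.  In words: «`Z = (2π/β)^{m/2} ×` (the weighted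
finite-dimensional BASE integral `∫ e^{−βf₀} w₀ det A^{−1/2}`) `× (1 ± poly/β)` + an exponentially small tail» — the fibre minimum `f₀(p)` is carried EXACTLY
into the base integral (it is moved into the amplitude `e^{−βf₀(p)}φ`, which the fibred core allows since its base weight is arbitrary).

HONEST FRAMING: generic real analysis ∕ measure theory; width 0 by itself toward any lattice statement; no ring deficit, no follower gap, no jet bound is
produced here; ⟨24197⟩, ⟨24196⟩, ⟨24194⟩, ⟨24497⟩ and every rung ∕ summit statement stay OPEN; own crux ⟨22884⟩ OPEN (blocked-on ⟨19935⟩); the Yang–Mills mass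
gap is NOT proved; no summit is proved by a line.  Width seat ym-line-sfw-p2-w2 g58 (cell ym-idea-1, free hands), `--supports stmt-QuantumFields-24197`.
THEOREMS ONLY (0 `def`, 0 `sorry`), standard axioms.

## References
* M. Hasenpflug, D. Rudolf, B. Sprungk, *Wasserstein convergence rates of increasingly concentrating probability measures*, Ann. Appl. Probab. 34 (2024),
  §3.1 Assumption 3, App. 4.1 Thm 16 ∕ Remark 17. [HasenpflugRudolfSprungk2024]
* K. W. Breitung, *Asymptotic Approximations for Probability Integrals*, LNM 1592 (1994), Thm 41 p. 56. [Breitung1994]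
-/

set_option autoImplicit false

noncomputable section

open _root_.MeasureTheory _root_.Filter _root_.Set _root_.Module _root_.Metric
open scoped _root_.Topology _root_.Real _root_.InnerProductSpace

namespace Summit.QuantumFields.YangMills.Theorems.QuantitativeLaplace

variable {M : Type*} [MeasurableSpace M] {ν : Measure M} [IsFiniteMeasure ν]
variable {Y : Type*} [Group Y] [MeasurableSpace Y] [MeasurableMul₂ Y] [MeasurableInv Y] {κ : Measure Y} [IsFiniteMeasure κ]
  [κ.IsMulLeftInvariant]
variable {V : Type*} [NormedAddCommGroup V] [InnerProductSpace ℝ V] [FiniteDimensional ℝ V]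
  [MeasurableSpace V] [BorelSpace V]

/-- ★★★ **Quantitative Laplace method on a skew product, fibrewise at the implicit minimiser, base-dependent fibre minimum.**
See the module docstring. [cite: HasenpflugRudolfSprungk2024, §3.1 Assumption 3 and App. 4.1 Thm 16] [cite: Breitung1994, Thm 41 p. 56] -/
theorem laplaceMethod_quantitative_skewProduct_of_taylor
    {E : V → Y} (hE : Measurable E) {s : M → Y} (hs : Measurable s) {R : ℝ} (hR : 0 < R)
    {j : V → ℝ} (hjm : Measurable j) (hj0 : ∀ y ∈ closedBall (0 : V) R, 0 ≤ j y)
    (hEB : MeasurableSet (E '' closedBall (0 : V) R))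
    (hchart1 : κ.restrict (E '' closedBall (0 : V) R) =
      (((volume : Measure V).restrict (closedBall (0 : V) R)).withDensity fun y => ENNReal.ofReal (j y)).map E)
    {A : M → V →ₗ[ℝ] V} (hA : ∀ p, (A p).IsSymmetric) {lam : ℝ} (hlam : 0 < lam)
    (hcoer : ∀ p (y : V), lam * ‖y‖ ^ 2 ≤ ⟪A p y, y⟫_ℝ)
    (hAm : Measurable fun z : M × V => ⟪A z.1 z.2, z.2⟫_ℝ)
    {B₃ B₄ N₁ N₂ β η₀ Φ₀ : ℝ} (hB₃ : 0 ≤ B₃) (hB₄ : 0 ≤ B₄) (hN₁ : 0 ≤ N₁) (hN₂ : 0 ≤ N₂) (hβ : 0 < β)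
    (hsmall : (B₃ + B₄ * R) * R + B₄ * R ^ 2 ≤ lam / (8 * ((finrank ℝ V : ℝ) + 8)))
    (hDR : (N₁ + N₂ * R) * R ≤ 1) (hGR : N₂ * R ^ 2 ≤ 1)
    {F φ : M × Y → ℝ} (hFm : Measurable F) (hφm : Measurable φ)
    {f₀ w₀ : M → ℝ} (hf₀m : Measurable f₀) (hf₀ : ∀ p, 0 ≤ f₀ p)
    (hw₀m : Measurable w₀) (hw₀ : ∀ p, 0 ≤ w₀ p) (hw₀i : Integrable w₀ ν)
    (hfT : ∀ p, ∃ τ : V → ℝ, (∀ y, τ (-y) = -τ y) ∧ (∀ y : V, ‖y‖ ≤ R → |τ y| ≤ B₃ * ‖y‖ ^ 3) ∧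
      ∀ y : V, ‖y‖ ≤ R → |F (p, s p * E y) - f₀ p - (1 / 2) * ⟪A p y, y⟫_ℝ - τ y| ≤ B₄ * ‖y‖ ^ 4)
    (hwT : ∀ p, ∃ lam' : V → ℝ, (∀ y, lam' (-y) = -lam' y) ∧ (∀ y : V, ‖y‖ ≤ R → |lam' y| ≤ N₁ * ‖y‖) ∧
      ∀ y : V, ‖y‖ ≤ R → |j y * φ (p, s p * E y) - w₀ p * (1 + lam' y)| ≤ N₂ * w₀ p * ‖y‖ ^ 2)
    (hout : ∀ x : M × Y, x ∉ (fun z : M × V => ((z.1, s z.1 * E z.2) : M × Y)) '' (univ ×ˢ closedBall (0 : V) R) →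
      f₀ x.1 + η₀ ≤ F x)
    (hΦ₀nn : 0 ≤ Φ₀) (hΦ₀ : ∀ x, |φ x| ≤ Φ₀) :
    Integrable (fun x => Real.exp (-(β * F x)) * φ x) (ν.prod κ) ∧
    |(∫ x, Real.exp (-(β * F x)) * φ x ∂(ν.prod κ)) -
        (2 * π / β) ^ ((finrank ℝ V : ℝ) / 2) * ∫ p, Real.exp (-(β * f₀ p)) * w₀ p / Real.sqrt (LinearMap.det (A p)) ∂ν| ≤
      (16 * ((finrank ℝ V : ℝ) + 8) / (lam * R ^ 2) + 16 * N₂ * ((finrank ℝ V : ℝ) + 8) / lam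
        + 256 * (B₄ + ((B₃ + B₄ * R) + B₄ * R) * ((N₁ + N₂ * R) + N₂ * R)) * ((finrank ℝ V : ℝ) + 8) ^ 2 / lam ^ 2
        + 18432 * ((B₃ + B₄ * R) + B₄ * R) ^ 2 * ((finrank ℝ V : ℝ) + 8) ^ 3 / lam ^ 3) / β *
        ((2 * π / β) ^ ((finrank ℝ V : ℝ) / 2) * ∫ p, Real.exp (-(β * f₀ p)) * w₀ p / Real.sqrt (LinearMap.det (A p)) ∂ν) +
      Φ₀ * (ν.prod κ).real univ * Real.exp (-(β * η₀)) := by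
  set B : Set V := closedBall (0 : V) R with hBdef
  set Ψ : M × V → M × Y := fun z => (z.1, s z.1 * E z.2) with hΨdef
  have hΨm : Measurable Ψ := measurable_fst.prodMk ((hs.comp measurable_fst).mul (hE.comp measurable_snd))
  obtain ⟨-, hΨT⟩ := measurableSet_image_skewChart (E := E) hs (B := B) hEB
  have hchart := skewChart_restrict_image_eq_map (ν := ν) (κ := κ) (vol := (volume : Measure V)) hE hs hjm hEB hchart1
  -- the shifted phase and the reweighted amplitude
  set f : M × Y → ℝ := fun x => F x - f₀ x.1 with hfdef
  set φ' : M × Y → ℝ := fun x => Real.exp (-(β * f₀ x.1)) * φ x with hφ'def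
  set w₀' : M → ℝ := fun p => Real.exp (-(β * f₀ p)) * w₀ p with hw₀'def
  have hfm : Measurable f := hFm.sub (hf₀m.comp measurable_fst)
  have hφ'm : Measurable φ' := (((hf₀m.comp measurable_fst).const_mul β).neg.exp).mul hφm
  have hw₀'m : Measurable w₀' := ((hf₀m.const_mul β).neg.exp).mul hw₀m
  have hexp_le : ∀ p, Real.exp (-(β * f₀ p)) ≤ 1 := fun p => by
    rw [Real.exp_le_one_iff]; nlinarith [hf₀ p, hβ]
  have hw₀' : ∀ p, 0 ≤ w₀' p := fun p => mul_nonneg (Real.exp_pos _).le (hw₀ p)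
  have hw₀'i : Integrable w₀' ν := by
    refine hw₀i.bdd_mul (c := 1) ((hf₀m.const_mul β).neg.exp.aestronglyMeasurable) (Eventually.of_forall fun p => ?_)
    rw [Real.norm_eq_abs, abs_of_pos (Real.exp_pos _)]
    exact hexp_le p
  -- Taylor data for the shifted phase / reweighted amplitude
  have hfT' : ∀ p, ∃ τ : V → ℝ, (∀ y, τ (-y) = -τ y) ∧ (∀ y : V, ‖y‖ ≤ R → |τ y| ≤ B₃ * ‖y‖ ^ 3) ∧
      ∀ y : V, ‖y‖ ≤ R → |f (Ψ (p, y)) - 0 - (1 / 2) * ⟪A p y, y⟫_ℝ - τ y| ≤ B₄ * ‖y‖ ^ 4 := by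
    intro p
    obtain ⟨τ, h1, h2, h3⟩ := hfT p
    refine ⟨τ, h1, h2, fun y hy => ?_⟩
    simpa only [hfdef, hΨdef, sub_zero] using h3 y hy
  have hwT' : ∀ p, ∃ lam' : V → ℝ, (∀ y, lam' (-y) = -lam' y) ∧ (∀ y : V, ‖y‖ ≤ R → |lam' y| ≤ N₁ * ‖y‖) ∧
      ∀ y : V, ‖y‖ ≤ R → |j (p, y).2 * φ' (Ψ (p, y)) - w₀' p * (1 + lam' y)| ≤ N₂ * w₀' p * ‖y‖ ^ 2 := by
    intro p
    obtain ⟨lam', h1, h2, h3⟩ := hwT p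
    refine ⟨lam', h1, h2, fun y hy => ?_⟩
    have hpos : 0 < Real.exp (-(β * f₀ p)) := Real.exp_pos _
    have heq : j (p, y).2 * φ' (Ψ (p, y)) - w₀' p * (1 + lam' y) =
        Real.exp (-(β * f₀ p)) * (j y * φ (p, s p * E y) - w₀ p * (1 + lam' y)) := by
      simp only [hφ'def, hw₀'def, hΨdef]; ring
    rw [heq, abs_mul, abs_of_pos hpos]
    calc Real.exp (-(β * f₀ p)) * |j y * φ (p, s p * E y) - w₀ p * (1 + lam' y)|
        ≤ Real.exp (-(β * f₀ p)) * (N₂ * w₀ p * ‖y‖ ^ 2) := mul_le_mul_of_nonneg_left (h3 y hy) hpos.le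
      _ = N₂ * w₀' p * ‖y‖ ^ 2 := by simp only [hw₀'def]; ring
  have hout' : ∀ x, x ∉ Ψ '' (univ ×ˢ B) → (0 : ℝ) + η₀ ≤ f x := fun x hx => by
    have h := hout x hx
    simp only [hfdef]; linarith
  have hΦ₀' : ∀ x, x ∉ Ψ '' (univ ×ˢ B) → |φ' x| ≤ Φ₀ := fun x _ => by
    simp only [hφ'def, abs_mul, abs_of_pos (Real.exp_pos _)]
    calc Real.exp (-(β * f₀ x.1)) * |φ x| ≤ 1 * |φ x| := mul_le_mul_of_nonneg_right (hexp_le x.1) (abs_nonneg _)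
      _ ≤ Φ₀ := by rw [one_mul]; exact hΦ₀ x
  -- ★ the fibred chart theorem
  obtain ⟨hint, hbd⟩ := laplaceMethod_quantitative_fibred_chart_of_taylor (μ := ν.prod κ) (ν := ν) (Ψ := Ψ) (J := fun z => j z.2)
    (f := f) (φ := φ') (f₀ := 0) hA hlam hcoer hAm hR hB₃ hB₄ hN₁ hN₂ hβ hsmall hDR hGR hΨm hΨT (hjm.comp measurable_snd)
    (fun z hz => hj0 z.2 hz.2) hchart hfm hφ'm hw₀'m hw₀' hw₀'i hfT' hwT' hout' hΦ₀nn hΦ₀'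
  -- rewrite the integrand `e^{−β(f − 0)} φ' = e^{−βF} φ` and the base integral
  have hI : (fun x : M × Y => Real.exp (-(β * (f x - 0))) * φ' x) = fun x => Real.exp (-(β * F x)) * φ x := by
    funext x
    simp only [hfdef, hφ'def, sub_zero]
    rw [← mul_assoc, ← Real.exp_add]
    congr 1; ring_nf
  have hJ : (fun p => w₀' p / Real.sqrt (LinearMap.det (A p))) = fun p => Real.exp (-(β * f₀ p)) * w₀ p / Real.sqrt (LinearMap.det (A p)) := by
    funext p; simp only [hw₀'def]
  rw [hI] at hint hbd
  rw [hJ] at hbd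
  exact ⟨hint, hbd⟩

end Summit.QuantumFields.YangMills.Theorems.QuantitativeLaplace

end
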